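import Literature.Computability.QuantumComplexity.GoldenCyclotomicArithmetic
import Literature.Computability.QuantumComplexity.PathModelEncodedQubits
import HarnessLib

/-!
# An exact sparse simulator of the `k = 5` path model over `ℤ[φ][ζ₅][√τ]`

Topic `Literature/Computability/QuantumComplexity`; sibling of `GoldenCyclotomicArithmetic.lean` (the
ring `K5 = ℤ[φ][ζ₅][√τ]` with its injective evaluation `K5.toComplex`) and
`PathModelTemperleyLieb.lean` (the column formula `col_ajlPhi` of the AJL generators). Every entry
of the Aharonov–Jones–Landau path-model matrices at `k = 5` lies in `K5` (AJL §3.1 eq. (3.1) with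
`λ_ℓ = sin(πℓ/5)`: the entries are `φ, τ, 1, √τ, 0` and the crossing weights `A^{±1} = ζ₅^{±1}`),
so a braid word acts on a finitely supported vector with `K5` coefficients by an EXACT, DECIDABLE
computation. This file implements that computation and proves it correct, so that identities of
the path-model representation on explicit vectors (the two-qubit gadgets of the Jones-hardness
reduction, Aharonov–Arad 2011 §3.2) become `decide`:

* `phiEntryK5 z bp bq ∈ K5` — the value `√(λ_{z+ε(bp)} λ_{z+ε(bq)})/λ_z` at the vertices
  `z ∈ {1,2,3,4}` of `G_5` (a `4 × 2 × 2` table: `φ, τ, 1, √τ, 0`), with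
  `toComplex_phiEntryK5` proving it against `ajlWeight 5`;
* sparse vectors `SVec n = List (QReg n × K5)` with value `evalS L = Σ (w,c) ∈ L, c • |w⟩`;
  `applyPhiS i`, `applyCrossingS i ε`, `mergeS` (combine equal labels), `applyWordS` (a time-ordered
  word, first letter first);
* **correctness**: `evalS_applyPhiS : evalS (applyPhiS i L) = Φ_i *ᵥ evalS L`,
  `evalS_applyCrossingS`, `evalS_mergeS`, and
  `evalS_applyWordS : evalS (applyWordS w L) = (w.reverse.map ρ).prod *ᵥ evalS L`.

## References

* D. Aharonov, V. Jones, Z. Landau, Algorithmica 55 (2009); arXiv:quant-ph/0511096, §3.1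
  eq. (3.1), §2.13 [AharonovJonesLandau2009].
* D. Aharonov, I. Arad, New J. Phys. 13 (2011) 035019, §3.2 [AharonovArad2011].
-/

noncomputable section

open Matrix

namespace Literature.Computability.QuantumComplexity

open Cryptography QuadraticAlgebra

/-! ### The entries of `Φ` at `k = 5` as elements of `K5` -/

namespace K5

/-- The base change `ℤ[φ] → K5`. [folklore] -/
def ofPhi (x : ZPhi) : K5 := ⟨⟨x, 0⟩, 0⟩

/-- `toComplex (ofPhi x) = toReal x`. [folklore] -/
@[simp] theorem toComplex_ofPhi (x : ZPhi) : toComplex (ofPhi x) = (ZPhi.toReal x : ℂ) := by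
  rw [ofPhi, toComplex_apply, ZPhiZeta.toComplex_apply]; simp

/-- `A⁻¹ = conj ζ₅ = τ - ζ` as an element of `K5`. [cite: AharonovJonesLandau2009, §2.13] -/
def zetaInv : K5 := ofZeta (star ZPhiZeta.zeta)

/-- `toComplex zetaInv = (ajlPoint 5)⁻¹`. [cite: AharonovJonesLandau2009, §2.13] -/
theorem toComplex_zetaInv : toComplex zetaInv = (ajlPoint 5)⁻¹ := by
  rw [zetaInv, toComplex_ofZeta, ZPhiZeta.toComplex_star, ZPhiZeta.toComplex_zeta, ← ajlPoint_five_eq_zeta5,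
    ajlPoint_inv]

/-- The crossing weights `A^{±1}` as elements of `K5` (same case table as `crossingWeight`).
[cite: AharonovJonesLandau2009, Def. 2.6] -/
def cw (positive smooth : Bool) : K5 := if positive = smooth then zeta else zetaInv

/-- `toComplex (cw ε sm) = crossingWeight A_5 ε sm`. [cite: AharonovJonesLandau2009, Def. 2.6] -/
theorem toComplex_cw (ε sm : Bool) : toComplex (cw ε sm) = crossingWeight (ajlPoint 5) ε sm := by
  unfold cw crossingWeight
  split_ifs
  · rw [toComplex_zeta, ajlPoint_five_eq_zeta5]
  · exact toComplex_zetaInv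

end K5

/-- **The `Φ`-entry table at `k = 5`**: `√(λ_{z+ε(bp)} λ_{z+ε(bq)})/λ_z` for `z ∈ {1,2,3,4}` as an
element of `K5` (`true` = step `+1`): at `z = 1`: `φ` for `(+,+)`, else `0`; at `z = 2`: `1` for
`(+,+)`, `τ` for `(-,-)`, `√τ` mixed; at `z = 3`: `τ` for `(+,+)`, `1` for `(-,-)`, `√τ` mixed; at
`z = 4`: `φ` for `(-,-)`, else `0`; `0` elsewhere. [cite: AharonovJonesLandau2009, §3.1 eq. (3.1)] -/
def phiEntryK5 (z : ℤ) (bp bq : Bool) : K5 :=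
  if z = 1 then (if bp ∧ bq then K5.ofPhi ZPhi.phi else 0)
  else if z = 2 then (if bp = bq then (if bp then 1 else K5.ofPhi ZPhi.tau) else K5.sqrtTau)
  else if z = 3 then (if bp = bq then (if bp then K5.ofPhi ZPhi.tau else 1) else K5.sqrtTau)
  else if z = 4 then (if ¬bp ∧ ¬bq then K5.ofPhi ZPhi.phi else 0)
  else 0

/-- `λ₄ = λ₁` (`sin(4π/5) = sin(π/5)`). [cite: AharonovJonesLandau2009, §3.1] -/
theorem ajlWeight_five_four : ajlWeight 5 4 = ajlWeight 5 1 := by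
  rw [ajlWeight_of_mem (by norm_num), ajlWeight_five_one,
    show Real.pi * ((4 : ℤ) : ℝ) / ((5 : ℕ) : ℝ) = Real.pi - Real.pi / 5 by push_cast; ring, Real.sin_pi_sub]

/-- `λ₅ = 0`. [cite: AharonovJonesLandau2009, §3.1] -/
theorem ajlWeight_five_five : ajlWeight 5 5 = 0 := ajlWeight_of_not (by norm_num)

/-- `toReal φ = φ`. [folklore] -/
theorem ZPhi.toReal_phi : ZPhi.toReal ZPhi.phi = Real.goldenRatio := by
  rw [ZPhi.toReal_apply]; simp [ZPhi.phi]

/-- **The table is correct**: for `1 ≤ z ≤ 4`,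
`toComplex (phiEntryK5 z bp bq) = √(λ_{z+ε(bp)} λ_{z+ε(bq)})/λ_z`. [cite: AharonovJonesLandau2009, §3.1 eq. (3.1)] -/
theorem toComplex_phiEntryK5 {z : ℤ} (hz : 1 ≤ z ∧ z ≤ 4) (bp bq : Bool) :
    K5.toComplex (phiEntryK5 z bp bq) =
      ((Real.sqrt (ajlWeight 5 (z + stepSign bp) * ajlWeight 5 (z + stepSign bq)) / ajlWeight 5 z : ℝ) : ℂ) := by
  have h2 : 0 < ajlWeight 5 2 := ajlWeight_five_two_pos
  have hst : Real.sqrt (ajlWeight 5 2 * ajlWeight 5 1) / ajlWeight 5 2 = ZPhiS.sqrtTau := by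
    have h := sqrt_ajlWeight_five_three_mul_one_div_two; rwa [ajlWeight_five_three] at h
  have hst' : Real.sqrt (ajlWeight 5 1 * ajlWeight 5 2) / ajlWeight 5 2 = ZPhiS.sqrtTau := by
    rw [mul_comm]; exact hst
  obtain ⟨hz1, hz4⟩ := hz
  interval_cases z <;> cases bp <;> cases bq
  · -- z = 1, (false, false)
    rw [show (1 : ℤ) + stepSign false = 0 by simp [stepSign]]
    rw [show phiEntryK5 1 false false = 0 from rfl, map_zero]
    rw [ajlWeight_five_zero]; simp
  · -- z = 1, (false, true)
    rw [show (1 : ℤ) + stepSign false = 0 by simp [stepSign], show (1 : ℤ) + stepSign true = 2 by simp [stepSign]]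
    rw [show phiEntryK5 1 false true = 0 from rfl, map_zero]
    rw [ajlWeight_five_zero]; simp
  · -- z = 1, (true, false)
    rw [show (1 : ℤ) + stepSign true = 2 by simp [stepSign], show (1 : ℤ) + stepSign false = 0 by simp [stepSign]]
    rw [show phiEntryK5 1 true false = 0 from rfl, map_zero]
    rw [ajlWeight_five_zero]; simp
  · -- z = 1, (true, true)
    rw [show (1 : ℤ) + stepSign true = 2 by simp [stepSign]]
    rw [show phiEntryK5 1 true true = K5.ofPhi ZPhi.phi from rfl, K5.toComplex_ofPhi, ZPhi.toReal_phi]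
    rw [Real.sqrt_mul_self (ajlWeight_nonneg _ _), ajlWeight_five_two_div_one]
  · -- z = 2, (false, false)
    rw [show (2 : ℤ) + stepSign false = 1 by simp [stepSign]]
    rw [show phiEntryK5 2 false false = K5.ofPhi ZPhi.tau from rfl, K5.toComplex_ofPhi, ZPhi.toReal_tau]
    rw [Real.sqrt_mul_self (ajlWeight_nonneg _ _), ajlWeight_five_one_div_two]
  · -- z = 2, (false, true)
    rw [show (2 : ℤ) + stepSign false = 1 by simp [stepSign], show (2 : ℤ) + stepSign true = 3 by simp [stepSign]]
    rw [show phiEntryK5 2 false true = K5.sqrtTau from rfl, K5.toComplex_sqrtTau]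
    rw [ajlWeight_five_three, hst']
  · -- z = 2, (true, false)
    rw [show (2 : ℤ) + stepSign true = 3 by simp [stepSign], show (2 : ℤ) + stepSign false = 1 by simp [stepSign]]
    rw [show phiEntryK5 2 true false = K5.sqrtTau from rfl, K5.toComplex_sqrtTau]
    rw [ajlWeight_five_three, hst]
  · -- z = 2, (true, true)
    rw [show (2 : ℤ) + stepSign true = 3 by simp [stepSign]]
    rw [show phiEntryK5 2 true true = 1 from rfl, map_one]
    rw [ajlWeight_five_three, Real.sqrt_mul_self (ajlWeight_nonneg _ _), div_self h2.ne']; simp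
  · -- z = 3, (false, false)
    rw [show (3 : ℤ) + stepSign false = 2 by simp [stepSign]]
    rw [show phiEntryK5 3 false false = 1 from rfl, map_one]
    rw [ajlWeight_five_three, Real.sqrt_mul_self (ajlWeight_nonneg _ _), div_self h2.ne']; simp
  · -- z = 3, (false, true)
    rw [show (3 : ℤ) + stepSign false = 2 by simp [stepSign], show (3 : ℤ) + stepSign true = 4 by simp [stepSign]]
    rw [show phiEntryK5 3 false true = K5.sqrtTau from rfl, K5.toComplex_sqrtTau]
    rw [ajlWeight_five_four, ajlWeight_five_three, hst]
  · -- z = 3, (true, false)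
    rw [show (3 : ℤ) + stepSign true = 4 by simp [stepSign], show (3 : ℤ) + stepSign false = 2 by simp [stepSign]]
    rw [show phiEntryK5 3 true false = K5.sqrtTau from rfl, K5.toComplex_sqrtTau]
    rw [ajlWeight_five_four, ajlWeight_five_three, hst']
  · -- z = 3, (true, true)
    rw [show (3 : ℤ) + stepSign true = 4 by simp [stepSign]]
    rw [show phiEntryK5 3 true true = K5.ofPhi ZPhi.tau from rfl, K5.toComplex_ofPhi, ZPhi.toReal_tau]
    rw [ajlWeight_five_four, ajlWeight_five_three, Real.sqrt_mul_self (ajlWeight_nonneg _ _), ajlWeight_five_one_div_two]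
  · -- z = 4, (false, false)
    rw [show (4 : ℤ) + stepSign false = 3 by simp [stepSign]]
    rw [show phiEntryK5 4 false false = K5.ofPhi ZPhi.phi from rfl, K5.toComplex_ofPhi, ZPhi.toReal_phi]
    rw [ajlWeight_five_three, ajlWeight_five_four, Real.sqrt_mul_self (ajlWeight_nonneg _ _), ajlWeight_five_two_div_one]
  · -- z = 4, (false, true)
    rw [show (4 : ℤ) + stepSign false = 3 by simp [stepSign], show (4 : ℤ) + stepSign true = 5 by simp [stepSign]]
    rw [show phiEntryK5 4 false true = 0 from rfl, map_zero]
    rw [ajlWeight_five_five]; simp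
  · -- z = 4, (true, false)
    rw [show (4 : ℤ) + stepSign true = 5 by simp [stepSign], show (4 : ℤ) + stepSign false = 3 by simp [stepSign]]
    rw [show phiEntryK5 4 true false = 0 from rfl, map_zero]
    rw [ajlWeight_five_five]; simp
  · -- z = 4, (true, true)
    rw [show (4 : ℤ) + stepSign true = 5 by simp [stepSign]]
    rw [show phiEntryK5 4 true true = 0 from rfl, map_zero]
    rw [ajlWeight_five_five]; simp

/-- On a valid walk the vertex before any bit is in `{1,2,3,4}`. [cite: AharonovJonesLandau2009, Def. 3.1] -/
theorem pathPos_mem_of_isGkPath {n : ℕ} {p : QReg n} (hp : IsGkPath 5 n p) {j : ℕ} (hj : j ≤ n) :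
    1 ≤ pathPos p j ∧ pathPos p j ≤ 4 := by
  have := hp.bounds hj; omega

/-! ### Sparse vectors with `K5` coefficients -/

/-- A sparse vector: a list of (basis label, coefficient) pairs; repeated labels add up.
[folklore] -/
abbrev SVec (n : ℕ) : Type := List (QReg n × K5)

variable {n : ℕ}

/-- The state vector denoted by a sparse vector: `Σ_{(w,c) ∈ L} toComplex c • |w⟩`. [folklore] -/
def evalS (L : SVec n) : QReg n → ℂ :=
  L.foldr (fun t acc => K5.toComplex t.2 • basisState t.1 + acc) 0

/-- `evalS [] = 0`. [folklore] -/
@[simp] theorem evalS_nil : evalS ([] : SVec n) = 0 := rfl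

/-- `evalS ((w, c) :: L) = c • |w⟩ + evalS L`. [folklore] -/
@[simp] theorem evalS_cons (t : QReg n × K5) (L : SVec n) :
    evalS (t :: L) = K5.toComplex t.2 • basisState t.1 + evalS L := rfl

/-- `evalS` is additive over concatenation. [folklore] -/
theorem evalS_append (L L' : SVec n) : evalS (L ++ L') = evalS L + evalS L' := by
  induction L with
  | nil => simp
  | cons t L ih => rw [List.cons_append, evalS_cons, evalS_cons, ih, add_assoc]

/-- Scaling every coefficient scales the value. [folklore] -/
theorem evalS_map_mul (L : SVec n) (c : K5) :
    evalS (L.map fun t => (t.1, t.2 * c)) = K5.toComplex c • evalS L := by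
  induction L with
  | nil => simp
  | cons t L ih => rw [List.map_cons, evalS_cons, evalS_cons, ih, smul_add, smul_smul, map_mul, mul_comm]

/-- **Apply `Φ_i`** to a sparse vector: each valid label with unequal bits at `i, i+1` produces its
diagonal term and its flipped term with the table coefficients; other labels are killed.
[cite: AharonovJonesLandau2009, §3.1 eq. (3.1)] -/
def applyPhiS (i : Fin (n - 1)) (L : SVec n) : SVec n :=
  L.flatMap fun t =>
    if IsGkPath 5 n t.1 ∧ t.1 (genSnd i) = !t.1 (genFst i) then
      [(t.1, t.2 * phiEntryK5 (pathPos t.1 i) (t.1 (genFst i)) (t.1 (genFst i))),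
        (flipTo t.1 i (!t.1 (genFst i)), t.2 * phiEntryK5 (pathPos t.1 i) (t.1 (genFst i)) (!t.1 (genFst i)))]
    else []

/-- **Apply the crossing `ρ(σ_i^ε) = c₁ Φ_i + c₂ 1`** to a sparse vector. [cite: AharonovJonesLandau2009, Def. 2.14] -/
def applyCrossingS (i : Fin (n - 1)) (ε : Bool) (L : SVec n) : SVec n :=
  (applyPhiS i L).map (fun t => (t.1, t.2 * K5.cw ε true)) ++ L.map (fun t => (t.1, t.2 * K5.cw ε false))

/-- Insert a term into a sparse vector, adding coefficients of equal labels. [folklore] -/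
def insertS (w : QReg n) (c : K5) : SVec n → SVec n
  | [] => [(w, c)]
  | t :: L => if t.1 = w then (t.1, t.2 + c) :: L else t :: insertS w c L

/-- **Merge**: combine all terms with equal labels. [folklore] -/
def mergeS (L : SVec n) : SVec n := L.foldr (fun t acc => insertS t.1 t.2 acc) []

/-- Drop zero coefficients. [folklore] -/
def pruneS (L : SVec n) : SVec n := L.filter fun t => decide (t.2 ≠ 0)

/-- **Apply a time-ordered braid word** (first letter acts first), merging and pruning after every
letter. [cite: AharonovJonesLandau2009, Def. 2.14] -/
def applyWordS (w : List (Fin (n - 1) × Bool)) (L : SVec n) : SVec n :=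
  w.foldl (fun acc l => pruneS (mergeS (applyCrossingS l.1 l.2 acc))) L

/-! ### Correctness -/

/-- `Φ_i` on one basis vector, sparse form. [cite: AharonovJonesLandau2009, §3.1 eq. (3.1)] -/
theorem evalS_applyPhiS_single (i : Fin (n - 1)) (w : QReg n) (c : K5) :
    evalS (applyPhiS i [(w, c)]) = ajlPhiC 5 n i *ᵥ (K5.toComplex c • basisState w) := by
  rw [mulVec_smul, basisState, Matrix.mulVec_single_one, col_ajlPhiC]
  unfold applyPhiS
  rw [List.flatMap_cons, List.flatMap_nil, List.append_nil]
  by_cases h : IsGkPath 5 n w ∧ w (genSnd i) = !w (genFst i)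
  · rw [if_pos h, col_ajlPhi h.1 h.2, ofReal_comp_smul_single_add, evalS_cons, evalS_cons, evalS_nil, add_zero,
      map_mul, map_mul, toComplex_phiEntryK5 (pathPos_mem_of_isGkPath h.1 (by omega)),
      toComplex_phiEntryK5 (pathPos_mem_of_isGkPath h.1 (by omega)), smul_add, smul_smul, smul_smul,
      ← ajlWeight_succ_mul_pred, Real.sqrt_mul_self (ajlWeight_nonneg _ _)]
  · rw [if_neg h, evalS_nil]
    have hz : ¬ IsGkPath 5 n w ∨ w (genSnd i) = w (genFst i) := by
      by_cases h1 : IsGkPath 5 n w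
      · right; cases hh : w (genFst i) <;> cases hh' : w (genSnd i) <;> simp_all
      · left; exact h1
    rw [col_ajlPhi_eq_zero hz]
    ext q; simp

/-- **`applyPhiS` is `Φ_i`.** [cite: AharonovJonesLandau2009, §3.1 eq. (3.1)] -/
theorem evalS_applyPhiS (i : Fin (n - 1)) (L : SVec n) : evalS (applyPhiS i L) = ajlPhiC 5 n i *ᵥ evalS L := by
  induction L with
  | nil => simp [applyPhiS]
  | cons t L ih =>
    have e : applyPhiS i (t :: L) = applyPhiS i [t] ++ applyPhiS i L := by
      unfold applyPhiS; rw [List.flatMap_cons, List.flatMap_cons, List.flatMap_nil, List.append_nil]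
    rw [e, evalS_append, ih, evalS_cons, mulVec_add, ← evalS_applyPhiS_single]

/-- **`applyCrossingS` is `ρ(σ_i^ε)`.** [cite: AharonovJonesLandau2009, Def. 2.14] -/
theorem evalS_applyCrossingS (i : Fin (n - 1)) (ε : Bool) (L : SVec n) :
    evalS (applyCrossingS i ε L) = ajlCrossingMatrix 5 (i, ε) *ᵥ evalS L := by
  rw [applyCrossingS, evalS_append, evalS_map_mul, evalS_map_mul, evalS_applyPhiS, K5.toComplex_cw, K5.toComplex_cw]
  change _ = (crossingWeight (ajlPoint 5) ε true • ajlPhiC 5 n i + crossingWeight (ajlPoint 5) ε false • (1 : Matrix _ _ ℂ)) *ᵥ evalS L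
  rw [add_mulVec, smul_mulVec, smul_mulVec, one_mulVec]

/-- Inserting adds the term. [folklore] -/
theorem evalS_insertS (w : QReg n) (c : K5) (L : SVec n) :
    evalS (insertS w c L) = K5.toComplex c • basisState w + evalS L := by
  induction L with
  | nil => simp [insertS]
  | cons t L ih =>
    unfold insertS
    split_ifs with h
    · rw [evalS_cons, evalS_cons, map_add, add_smul, ← h]; abel
    · rw [evalS_cons, evalS_cons, ih]; abel

/-- **Merging preserves the value.** [folklore] -/
theorem evalS_mergeS (L : SVec n) : evalS (mergeS L) = evalS L := by
  induction L with
  | nil => rfl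
  | cons t L ih =>
    show evalS (insertS t.1 t.2 (mergeS L)) = _
    rw [evalS_insertS, ih, evalS_cons]

/-- **Pruning preserves the value.** [folklore] -/
theorem evalS_pruneS (L : SVec n) : evalS (pruneS L) = evalS L := by
  induction L with
  | nil => rfl
  | cons t L ih =>
    unfold pruneS at ih ⊢
    rw [List.filter_cons]
    by_cases h : t.2 ≠ 0
    · rw [if_pos (by simpa using h), evalS_cons, evalS_cons, ih]
    · push Not at h
      rw [if_neg (by simp [h]), ih, evalS_cons, h, map_zero, zero_smul, zero_add]

/-- **`applyWordS` is the braid operator**: for a time-ordered word `w` (first letter acts first),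
`evalS (applyWordS w L) = (w.reverse.map ρ).prod *ᵥ evalS L`. [cite: AharonovJonesLandau2009, Def. 2.14] -/
theorem evalS_applyWordS (w : List (Fin (n - 1) × Bool)) (L : SVec n) :
    evalS (applyWordS w L) = (w.reverse.map fun l => ajlCrossingMatrix 5 l).prod *ᵥ evalS L := by
  induction w using List.reverseRecOn generalizing L with
  | nil => simp [applyWordS]
  | append_singleton w l ih =>
    rw [applyWordS, List.foldl_append, List.foldl_cons, List.foldl_nil, ← applyWordS, evalS_pruneS, evalS_mergeS,
      evalS_applyCrossingS, ih, List.reverse_append, List.reverse_singleton, List.singleton_append, List.map_cons,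
      List.prod_cons, mulVec_mulVec]

end Literature.Computability.QuantumComplexity

end
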